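import Mathlib.Algebra.Order.Field.GeomSum
import Mathlib.Analysis.SpecificLimits.Basic
import Mathlib.RingTheory.Coprime.Lemmas
import Mathlib.Data.Nat.Prime.Basic
import Mathlib.Tactic
import HarnessLib

/-!
# Harman–Kátai: a sparse dyadic rational near `a/q` forces `q` to be a power of two
# (Green 2012, Lemma 1), proved

Topic `Literature/NumberTheory/LFunctions`, companion of `WalshFourierKatai.lean` (Green's
Proposition 2) and `MoebiusTwoPowerModuli.lean` (Green's Theorem 3). Everything here is PROVED;
there are no definitions and no named facts.

B. Green, *On (not) computing the Möbius function using bounded depth circuits*, Combin. Probab.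
Comput. 21 (2012) 942–951 (arXiv:1103.4991), §4, **Lemma 1** ("the following key observation of
Harman and Kátai [*Primes with preassigned digits II*, Acta Arith. 133 (2008)]"):

> Suppose that `θ = r_1/2^{i_1} + ⋯ + r_k/2^{i_k}`, where `i_1 < ⋯ < i_k ≤ n` and `|r_i| ≤ Q`
> for all `i`. Suppose furthermore that there is some `q ≤ Q` and an `a` coprime to `q` such
> that `|θ - a/q| ≤ Q/N` (`N = 2ⁿ`), and that we have `2^{n/2k} > 4Q²`. Then `q` is a power of
> two.

## Statement proved and the (harmless) reformulation of the gap hypothesis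

`isPowTwo_of_near_sparseDyadic`: for a finite set `I` of exponents with `|I| ≤ k`, integers
`r_i` with `|r_i| ≤ Q` (`i ∈ I`), `θ = Σ_{i∈I} r_i/2^i`, natural numbers `g`, `n` with
`(k + 1) g ≤ n` and `4Q² < 2^g`, and `1 ≤ q ≤ Q`, `a ∈ ℤ` coprime to `q` with
`|θ - a/q| ≤ Q/2ⁿ`: `q = 2^m` for some `m`. Green's hypothesis "`2^{n/2k} > 4Q²`" enters his
proof only through the pigeonhole step "some two consecutive exponents among
`0 = i_0 < i_1 < ⋯ < i_k < i_{k+1} = n` differ by at least `n/2k`"; we take the gap length `g`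
as the parameter (`(k+1) g ≤ n` guarantees, by pigeonhole over the `k + 1` disjoint windows
`(tg, tg + g)`, `0 ≤ t ≤ k`, a window free of exponents — `exists_free_window`) and ask
`4Q² < 2^g` for it; with `g = ⌈n/2k⌉` this is exactly the printed lemma (for `k ≥ 1`,
`(k+1)⌈n/2k⌉ ≤ n` as soon as `n ≥ 2k(k+1)`, which the application `k < √n` of Green's
Proposition 3 provides up to the usual adjustment of constants), and the set `I` need not be
sorted, nor contained in `{1, …, n}`. `isPowTwo_of_near_sparseDyadic_fin` restates it for
digit-indexed frequencies `θ = Σ_{j ∈ A} r_j/2^{j+1}`, `A ⊆ Fin n` (the output format of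
`Literature.NumberTheory.LFunctions.Katai.exists_sparse_dyadic_of_large_walsh`).

## Proof (Green, loc. cit.)

With a free window `(e, e + g)`, `e + g ≤ n`, put `q' = 2^e`,
`a' = Σ_{i ∈ I, i ≤ e} r_i 2^{e-i} ∈ ℤ`. The remaining exponents are `≥ e + g`, so
`|θ - a'/q'| ≤ Q Σ_{i ≥ e+g} 2^{-i} ≤ 2Q/2^{e+g}` (`sum_two_zpow_neg_le`), and `Q/2ⁿ ≤ Q/2^{e+g}`;
hence `|a/q - a'/q'| ≤ 3Q 2^{-g}/q' < (3/4)/(Q q') < 1/(q q')` by `4Q² < 2^g` and `q ≤ Q`.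
Therefore `a q' = a' q`, so `q ∣ a 2^e` and, `a` being coprime to `q`, `q ∣ 2^e`: `q` is a
power of two (Green writes "`q = q'`"; only `q ∣ q'` follows and is what is used).

## References

* B. Green, Combin. Probab. Comput. 21 (2012), §4, Lemma 1 [Green2012].
* G. Harman, I. Kátai, *Primes with preassigned digits II*, Acta Arith. 133 (2008) 171–184 (the
  original observation; cited through Green).
-/

open Finset

namespace Literature.NumberTheory.LFunctions.HarmanKatai

/-- **Pigeonhole for free windows.** If `|I| ≤ k` then one of the `k + 1` disjoint windows
`(tg, tg + g)`, `0 ≤ t ≤ k`, contains no element of `I`. [cite: Green2012, §4, Lemma 1 (proof, pigeonhole step)] -/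
theorem exists_free_window (I : Finset ℕ) {k : ℕ} (hI : I.card ≤ k) (g : ℕ) :
    ∃ t ≤ k, ∀ i ∈ I, ¬ (t * g < i ∧ i < t * g + g) := by
  classical
  by_contra hcon
  push Not at hcon
  -- every window meets `I`: choose a witness in each
  choose f hfI hfw using fun t : Fin (k + 1) => hcon t (Nat.lt_succ_iff.1 t.isLt)
  have hinj : Function.Injective f := by
    intro t t' h
    have h1 := hfw t
    have h2 := hfw t'
    rw [h] at h1
    apply Fin.ext
    -- the windows `(tg, tg+g)` are disjoint
    by_contra hne
    rcases Nat.lt_or_gt_of_ne hne with hlt | hlt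
    · have h3 : ((t : ℕ) + 1) * g ≤ (t' : ℕ) * g := Nat.mul_le_mul_right g hlt
      rw [Nat.add_mul, one_mul] at h3
      omega
    · have h3 : ((t' : ℕ) + 1) * g ≤ (t : ℕ) * g := Nat.mul_le_mul_right g hlt
      rw [Nat.add_mul, one_mul] at h3
      omega
  have hcard : (Finset.univ : Finset (Fin (k + 1))).card ≤ I.card :=
    Finset.card_le_card_of_injOn f (fun t _ => hfI t) (hinj.injOn)
  rw [Finset.card_univ, Fintype.card_fin] at hcard
  omega

/-- `Σ_{i ∈ T} 2^{-i} ≤ 2 · 2^{-L}` when every element of `T` is at least `L`. [folklore] -/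
theorem sum_two_zpow_neg_le (T : Finset ℕ) {L : ℕ} (hT : ∀ i ∈ T, L ≤ i) :
    ∑ i ∈ T, (1 / 2 : ℝ) ^ i ≤ 2 * (1 / 2 : ℝ) ^ L := by
  rcases T.eq_empty_or_nonempty with rfl | hne
  · simp
  · set M := T.max' hne with hM
    have hsub : T ⊆ Ico L (M + 1) := fun i hi =>
      mem_Ico.2 ⟨hT i hi, Nat.lt_succ_of_le (T.le_max' i hi)⟩
    calc ∑ i ∈ T, (1 / 2 : ℝ) ^ i ≤ ∑ i ∈ Ico L (M + 1), (1 / 2 : ℝ) ^ i :=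
          sum_le_sum_of_subset_of_nonneg hsub fun _ _ _ => by positivity
      _ ≤ (1 / 2 : ℝ) ^ L / (1 - 1 / 2) := geom_sum_Ico_le_of_lt_one (by norm_num) (by norm_num)
      _ = 2 * (1 / 2 : ℝ) ^ L := by ring

/-- **Harman–Kátai (Green 2012, Lemma 1).** Let `θ = Σ_{i ∈ I} r_i/2^i` be a sparse dyadic
rational: `|I| ≤ k`, `|r_i| ≤ Q`. Let `g, n` with `(k+1) g ≤ n` and `4Q² < 2^g`. If
`|θ - a/q| ≤ Q/2ⁿ` for some `1 ≤ q ≤ Q` and an integer `a` coprime to `q`, then `q` is a power of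
two. (Green's form: exponents `i_1 < ⋯ < i_k ≤ n` and `2^{n/2k} > 4Q²`; see the module docstring
for the reformulation of the gap hypothesis.) [cite: Green2012, §4, Lemma 1] -/
theorem isPowTwo_of_near_sparseDyadic (I : Finset ℕ) {k g n Q : ℕ} (hIk : I.card ≤ k)
    (hgn : (k + 1) * g ≤ n) (r : ℕ → ℤ) (hr : ∀ i ∈ I, |r i| ≤ Q) (hQ : 4 * Q ^ 2 < 2 ^ g)
    {q : ℕ} (hq : 1 ≤ q) (hqQ : q ≤ Q) {a : ℤ} (hcop : IsCoprime a q)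
    (hθ : |∑ i ∈ I, (r i : ℝ) / 2 ^ i - a / q| ≤ Q / 2 ^ n) :
    ∃ m : ℕ, q = 2 ^ m := by
  classical
  obtain ⟨t, htk, hfree⟩ := exists_free_window I hIk g
  set e : ℕ := t * g with he
  have heg : e + g ≤ n := by
    have : (t + 1) * g ≤ (k + 1) * g := Nat.mul_le_mul_right g (by omega)
    rw [he]; nlinarith
  have hQ1 : (1 : ℝ) ≤ Q := by exact_mod_cast hq.trans hqQ
  have hQ0 : (0 : ℝ) < Q := by linarith
  have hq0 : (0 : ℝ) < q := by exact_mod_cast hq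
  -- the integer `a'` and the split of `θ`
  set Ilo := I.filter (fun i => i ≤ e) with hIlo
  set Ihi := I.filter (fun i => ¬ i ≤ e) with hIhi
  set a' : ℤ := ∑ i ∈ Ilo, r i * 2 ^ (e - i) with ha'
  have hsplit : ∑ i ∈ I, (r i : ℝ) / 2 ^ i = (a' : ℝ) / 2 ^ e + ∑ i ∈ Ihi, (r i : ℝ) / 2 ^ i := by
    rw [← sum_filter_add_sum_filter_not I (fun i => i ≤ e), ha']
    congr 1
    push_cast
    rw [sum_div]
    refine sum_congr rfl fun i hi => ?_
    have hie : i ≤ e := (mem_filter.1 hi).2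
    have h2 : (2 : ℝ) ^ e = 2 ^ (e - i) * 2 ^ i := by rw [← pow_add, Nat.sub_add_cancel hie]
    rw [h2]
    field_simp
  -- the tail: exponents `≥ e + g`
  have hhi : ∀ i ∈ Ihi, e + g ≤ i := by
    intro i hi
    rw [hIhi, mem_filter] at hi
    have := hfree i hi.1
    omega
  have htail : |∑ i ∈ Ihi, (r i : ℝ) / 2 ^ i| ≤ 2 * Q * (1 / 2 : ℝ) ^ (e + g) := by
    calc |∑ i ∈ Ihi, (r i : ℝ) / 2 ^ i| ≤ ∑ i ∈ Ihi, |(r i : ℝ) / 2 ^ i| := abs_sum_le_sum_abs _ _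
      _ ≤ ∑ i ∈ Ihi, Q * (1 / 2 : ℝ) ^ i := by
          refine sum_le_sum fun i hi => ?_
          have h2i : (0 : ℝ) < 2 ^ i := by positivity
          rw [abs_div, abs_of_pos h2i, div_eq_mul_one_div, ← one_div_pow]
          gcongr
          rw [← Int.cast_abs]
          exact_mod_cast hr i (mem_filter.1 hi).1
      _ = Q * ∑ i ∈ Ihi, (1 / 2 : ℝ) ^ i := by rw [mul_sum]
      _ ≤ Q * (2 * (1 / 2 : ℝ) ^ (e + g)) := by gcongr; exact sum_two_zpow_neg_le Ihi hhi
      _ = 2 * Q * (1 / 2 : ℝ) ^ (e + g) := by ring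
  -- `|a/q - a'/2^e| ≤ 3Q/2^(e+g)`
  have hpow : (1 / 2 : ℝ) ^ (e + g) = 1 / (2 ^ e * 2 ^ g) := by rw [one_div_pow, pow_add]
  have hN : (Q : ℝ) / 2 ^ n ≤ Q * (1 / 2 : ℝ) ^ (e + g) := by
    rw [hpow, ← pow_add, mul_one_div]
    exact div_le_div_of_nonneg_left hQ0.le (by positivity) (pow_le_pow_right₀ (by norm_num) heg)
  have hdiff : |(a : ℝ) / q - (a' : ℝ) / 2 ^ e| ≤ 3 * Q * (1 / 2 : ℝ) ^ (e + g) := by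
    have h1 : (a : ℝ) / q - (a' : ℝ) / 2 ^ e =
        (∑ i ∈ Ihi, (r i : ℝ) / 2 ^ i) - (∑ i ∈ I, (r i : ℝ) / 2 ^ i - a / q) := by
      rw [hsplit]; ring
    rw [h1]
    refine (abs_sub _ _).trans ?_
    linarith [hθ.trans hN]
  -- `3Q/2^(e+g) < 1/(q 2^e)` from `4Q² < 2^g` and `q ≤ Q`
  have hlt : |(a : ℝ) / q - (a' : ℝ) / 2 ^ e| < 1 / (q * 2 ^ e) := by
    refine hdiff.trans_lt ?_
    rw [hpow, lt_div_iff₀ (by positivity)]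
    have hQ' : (4 : ℝ) * Q ^ 2 < 2 ^ g := by exact_mod_cast hQ
    have hqQ' : (q : ℝ) ≤ Q := by exact_mod_cast hqQ
    have h2e : (0 : ℝ) < 2 ^ e := by positivity
    calc (3 : ℝ) * Q * (1 / (2 ^ e * 2 ^ g)) * (q * 2 ^ e) = 3 * (Q : ℝ) * q / 2 ^ g := by
          field_simp
      _ ≤ 3 * (Q : ℝ) * Q / 2 ^ g := by gcongr
      _ < 1 := by rw [div_lt_one (by positivity)]; nlinarith
  -- hence `a 2^e = a' q`
  have heq : a * 2 ^ e = a' * q := by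
    have h1 : |((a * 2 ^ e - a' * q : ℤ) : ℝ)| < 1 := by
      have h2 : ((a * 2 ^ e - a' * q : ℤ) : ℝ) = ((a : ℝ) / q - (a' : ℝ) / 2 ^ e) * (q * 2 ^ e) := by
        push_cast; field_simp
      have hq2 : (0 : ℝ) < q * 2 ^ e := by positivity
      rw [h2, abs_mul, abs_of_pos hq2]
      calc |(a : ℝ) / q - (a' : ℝ) / 2 ^ e| * (q * 2 ^ e) < 1 / (q * 2 ^ e) * (q * 2 ^ e) := by gcongr
        _ = 1 := by field_simp
    have h3 : |(a * 2 ^ e - a' * q : ℤ)| < 1 := by exact_mod_cast h1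
    have h4 : a * 2 ^ e - a' * q = 0 := Int.abs_lt_one_iff.1 h3
    linarith
  -- `q ∣ a 2^e`, `(a, q) = 1` ⇒ `q ∣ 2^e` ⇒ `q = 2^m`
  have hdvd : (q : ℤ) ∣ a * 2 ^ e := ⟨a', by rw [heq]; ring⟩
  have hdvd' : (q : ℤ) ∣ 2 ^ e := hcop.symm.dvd_of_dvd_mul_left hdvd
  have hdvdN : q ∣ 2 ^ e := by exact_mod_cast hdvd'
  obtain ⟨m, -, hm⟩ := (Nat.dvd_prime_pow Nat.prime_two).1 hdvdN
  exact ⟨m, hm⟩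

/-- **Harman–Kátai (Green 2012, Lemma 1), digit-indexed form.** For `θ = Σ_{j ∈ A} r_j/2^{j+1}`,
`A ⊆ {0,…,n-1}`, `|A| ≤ k`, `|r_j| ≤ Q` — the format produced by
`Literature.NumberTheory.LFunctions.Katai.exists_sparse_dyadic_of_large_walsh` — with
`(k+1) g ≤ n`, `4Q² < 2^g`, `1 ≤ q ≤ Q`, `a` coprime to `q` and `|θ - a/q| ≤ Q/2ⁿ`: `q` is a power
of two. [cite: Green2012, §4, Lemma 1] -/
theorem isPowTwo_of_near_sparseDyadic_fin {n k g Q : ℕ} (A : Finset (Fin n)) (hAk : A.card ≤ k)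
    (hgn : (k + 1) * g ≤ n) (r : Fin n → ℤ) (hr : ∀ j ∈ A, |r j| ≤ Q) (hQ : 4 * Q ^ 2 < 2 ^ g)
    {q : ℕ} (hq : 1 ≤ q) (hqQ : q ≤ Q) {a : ℤ} (hcop : IsCoprime a q)
    (hθ : |∑ j ∈ A, (r j : ℝ) / 2 ^ ((j : ℕ) + 1) - a / q| ≤ Q / 2 ^ n) :
    ∃ m : ℕ, q = 2 ^ m := by
  classical
  -- exponents `i = j + 1` and coefficients `r' i = r (i - 1)`
  set I : Finset ℕ := A.image (fun j : Fin n => (j : ℕ) + 1) with hI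
  set r' : ℕ → ℤ := fun i => if h : i - 1 < n then r ⟨i - 1, h⟩ else 0 with hr'
  have hinj : Set.InjOn (fun j : Fin n => (j : ℕ) + 1) A := fun j _ j' _ h => Fin.ext (by simpa using h)
  have hIk : I.card ≤ k := by rw [hI, card_image_of_injOn hinj]; exact hAk
  have hr'eq : ∀ j : Fin n, r' ((j : ℕ) + 1) = r j := by
    intro j
    simp only [hr', Nat.add_sub_cancel, dif_pos j.isLt]
  have hsum : ∑ i ∈ I, (r' i : ℝ) / 2 ^ i = ∑ j ∈ A, (r j : ℝ) / 2 ^ ((j : ℕ) + 1) := by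
    rw [hI, sum_image hinj]
    exact sum_congr rfl fun j _ => by rw [hr'eq]
  refine isPowTwo_of_near_sparseDyadic I hIk hgn r' (fun i hi => ?_) hQ hq hqQ hcop (by rwa [hsum])
  rw [hI, mem_image] at hi
  obtain ⟨j, hj, rfl⟩ := hi
  rw [hr'eq]
  exact hr j hj

end Literature.NumberTheory.LFunctions.HarmanKatai
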